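import Summits.QuantumFields.BalabanUV.Beta.EriceRemainderEnclosureHistoryAutonomyComparisonDualContractionLinks

/-!
# EriceRemainderEnclosureHistoryAutonomyComparisonDualContraction — (E138) **THE CONTRACTION CLASS: COMPARISON FOR EVERY ISOTONE EXCESS OVER EVERY ISOTONE
# MEMORY WHOSE LEVEL-LIPSCHITZ AGE MOMENT IS BELOW ONE.**  `B` isotone on the box `]0,γ]^ℕ` (floor `b > 0`, zeroth moment `M` — existence ∕ uniqueness of the base
# family only) and LEVEL-LIPSCHITZ IN ITS HISTORY with an age profile `Λ ≥ 0`: `B u − B v ≤ Σ_{k<K} Λ_k·(1∕v_k² − 1∕u_k²)⁺` for box configurations whose age-`k`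
# levels are at least `1∕γ² + (k+1)·b` (the GRADED box — every tail an orbit visits lies there), with **`θ := Σ_{k<K} k·Λ_k < 1`** (the age-`0` weight is free);
# `B′` ANY functional with `B ≤ B′ ≤ β̄` on the box and ISOTONE excess `B′ − B` — NO modulus, steepness, size or threshold on the excess; `h`, `h′` ANY box solutions
# of `B`, `B′` from one pin.  Then **`h′ ≤ h` at every scale** (`le_of_isotone_excess_moment`).  SHARP: (E56a) `…ComparisonIsotoneExcessSharp` is the one-age
# profile `Λ_L = M̃` (hinge `b + M̃·max(1 − 1∕u_L², 0)` in the LEVEL of age `L`) and comparison FAILS there exactly when `L·M̃ > 1`.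

Cell `pub-balaban`, β-function sub-cell, BINDER row D4 «RemainderConst leaves for Bałaban's split» (`HOME/BINDER-OWNERS.md`; owner lineage `b2b-balaban-beta-an4`;
this file by co-owner #2 lineage `b2b-balaban-beta-d4-p2`, generation 106), β-FLOW TEAM duty (1), FREEZE (0) honoured (def-free; (E138a) `sandwich_of_links` ∕ `tail_graded` ∕
`dual_step_eq_levels` ∕ `gap_le_sum_parts`, (E132) `cmp_of_dual_steps_nonneg`, (E48a) `strictAnti_of_memFlow`, (E39) `exists_memFlow_zm`, (E43b)
`memFlow_unique_of_monotone_zm` BY NAME; nothing restated).  Successor item (α″) of `HOME/b2b-balaban-beta-d4-p2/HANDOFF.gen105.md` («isotone memory with a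
STEEPNESS bound relative to the box + isotone excess ⟹ comparison; needs a bookkeeping other than the staircase ∕ chord method of (E133)–(E137)»): the steepness
bound is the level-Lipschitz age moment, and the bookkeeping is a CONTRACTION.

HONEST FRAMING (page 1, verbatim and binding).  *"Discharging BetaPertH makes Bałaban's UV stability UNCONDITIONAL — a real constructive-QFT result; it is
NOT the continuum limit and NOT the Clay problem."*  THIS FILE DISCHARGES NOTHING OF THE KIND.  Elementary real analysis about ABSTRACT functionals on a box
]0,γ]^ℕ (node U2's `MemFlow` ∕ `SeqBox`) — hypotheses of a census, not facts: whether Bałaban's (1.22) limit functional is isotone, level-Lipschitz in its history,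
or has age moment below one is NOT PRINTED ([I] p. 298; GAPS G-t4-U2-1∕-2) and NOT asserted.  Row D4 class UNCHANGED (critical-path width 0; instance 0∕1;
D4 DISCHARGE NO DATE).  NOT B12 Thm 2, NOT BetaPertH, NOT continuum YM, NOT Clay.

THE IDEA (new relative to (E133)–(E137): no row inequality, no gauge, no staircase, no induction on the depth, no base case).  Fix ONE perturbed orbit `h′` and the
base family `S` restarted at its points; `X_n := B′(tail_{n+1}h′) − B(tail_1 S h′_n) = 1∕h′_{n+1}² − 1∕(S h′_n)_1²` the DUAL STEP ((E132)), `E_n := (B′−B)(tail_{n+1}h′) ≥ 0`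
the SOURCE (non-increasing in `n`: isotone excess read on the tails of one decreasing orbit).  `X_n = E_n − drop_n`, `drop_n = B(tail_1 S h′_n) − B(tail_{n+1}h′)`.
(1) WINDOW GAPS WITHOUT SIGNS ((E138a) `gap_le_sum_parts`): the age-`k` level gap `1∕h′_{n+1+k}² − 1∕(S h′_n)_{1+k}²` lies between `−Σ_{l≤k} X⁻_{n+l}` and `Σ_{l≤k} X⁺_{n+l}`
(telescope through the base orbits from the intermediate points; each pin gap `X_{n+l}` is damped along the base family in either order, `base_level_gap_between`).
(2) LINKS (§3): by the profile, `E_n − X_n = drop_n ≤ Σ_k Λ_k·gap_k⁺ ≤ Σ_k Λ_k Σ_{l≤k} X⁺_{n+l}` and `X_n − E_n ≤ Σ_k Λ_k Σ_{l≤k} X⁻_{n+l}`.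
(3) CONTRACTION ((E138a) §1, pure sequences): call `v_n := max(X⁻_n, X_n − E_n)` the violation.  If `v ≤ C` everywhere then `v ≤ θ·C` everywhere: a negative step
`X_n = −ν` has `X⁺_n = 0`, so `E_n + ν ≤ Σ_k Λ_k Σ_{1≤l≤k}(E_{n+l} + C) ≤ θ(E_n + C)`, i.e. `ν ≤ θC − (1−θ)E_n ≤ θC`; an overshoot `X_n − E_n = ω > 0` has `X⁻_n = 0`, so
`ω ≤ Σ_k Λ_k·k·C = θC`.  Iterating, `v ≤ θ^j·β̄ → 0`: **`0 ≤ X_n ≤ E_n` at every depth** (`dual_steps_sandwich`), and `X ≥ 0` is comparison ((E132) `cmp_of_dual_steps_nonneg`).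
The violation sizes a failure would need grow like `θ^{−j}` along the orbit — impossible for bounded functionals; at `θ > 1` they may shrink, and (E56a)'s hinge
realises exactly that with ONE negative step at the top paid by `L` overshoots below.

WHAT IS PROVED ([folklore]; 0 `def`, 0 sorry).  §3 **`flow_link_lower`**, **`flow_link_upper`**, `flow_violation_bound`, `flow_source_le`.  §4 **`dual_steps_sandwich`**,
**`le_of_isotone_excess_moment`**.  (§1 the contraction on sequences and §2 the flow bricks are (E138a) `…ComparisonDualContractionLinks`.)
-/

noncomputable section
open Finset Set

namespace Summit.QuantumFields.BalabanUV.Beta.EriceRemainderEnclosureHistoryAutonomyComparisonDualContraction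

open Literature.MathematicalPhysics.QuantumFieldTheory.Balaban1983to89
open Literature.MathematicalPhysics.QuantumFieldTheory.Balaban1983to89.T4BetaStationary
open Literature.MathematicalPhysics.QuantumFieldTheory.Balaban1983to89.T4BetaFlowWellPosed
open Summit.QuantumFields.BalabanUV.Beta.EriceRemainderEnclosureHistoryAutonomyOrder (strictAnti_of_memFlow)
open Summit.QuantumFields.BalabanUV.Beta.EriceRemainderEnclosureHistoryAutonomyComparisonDualOrbit (cmp_of_dual_steps_nonneg)
open Summit.QuantumFields.BalabanUV.Beta.EriceRemainderEnclosureHistoryAutonomyComparisonDualContractionLinks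
  (sandwich_of_links tail_graded dual_step_eq_levels gap_le_sum_parts)

variable {B B' : (ℕ → ℝ) → ℝ} {M γ b : ℝ} {S : ℝ → ℕ → ℝ} {h h' : ℕ → ℝ}

/-! ## §3 The two link inequalities, the initial bound and the source along ONE perturbed orbit -/

/-- **THE LOWER LINK** (a negative dual step is paid by the window's positive parts).  Base package; LEVEL-LIPSCHITZ AGE PROFILE `Λ ≥ 0` of `B` on the GRADED box
(`B u − B v ≤ Σ_{k<K} Λ_k·(1∕v_k² − 1∕u_k²)⁺` whenever `u, v ∈ ]0,γ]^ℕ` have age-`k` levels `≥ 1∕γ² + (k+1)·b`); `B ≤ B′` on the box; `h′` a box solution of `B′`.  Then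
`E_n − X_n ≤ Σ_k Λ_k Σ_{l≤k} X⁺_{n+l}` with `E_n = (B′−B)(tail_{n+1}h′)` and `X` the dual steps in level form: `E_n − X_n` IS the memory drop
`B(tail_1 S h′_n) − B(tail_{n+1}h′)`, bounded by the profile against the positive window gaps (`gap_le_sum_parts`). [folklore] -/
theorem flow_link_lower {Λ : ℕ → ℝ} {K : ℕ} (hb : 0 < b)
    (hmono : ∀ u v : ℕ → ℝ, SeqBox γ u → SeqBox γ v → (∀ i, u i ≤ v i) → B u ≤ B v)
    (hB : ∀ u u' : ℕ → ℝ, SeqBox γ u → SeqBox γ u' → ∀ D : ℝ, (∀ j, |u j - u' j| ≤ D) → |B u - B u'| ≤ M * D) (hM : 0 ≤ M)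
    (hlo : ∀ u, SeqBox γ u → b ≤ B u)
    (hS : ∀ p, 0 < p → p ≤ γ → SeqBox γ (S p) ∧ MemFlow B p (S p))
    (huniq : ∀ p, 0 < p → p ≤ γ → ∀ u u' : ℕ → ℝ, SeqBox γ u → SeqBox γ u' → MemFlow B p u → MemFlow B p u' → u = u')
    (hΛ : ∀ k, 0 ≤ Λ k)
    (hLip : ∀ u v : ℕ → ℝ, SeqBox γ u → SeqBox γ v → (∀ k : ℕ, 1 / γ ^ 2 + ((k : ℝ) + 1) * b ≤ 1 / u k ^ 2) →
      (∀ k : ℕ, 1 / γ ^ 2 + ((k : ℝ) + 1) * b ≤ 1 / v k ^ 2) → B u - B v ≤ ∑ k ∈ range K, Λ k * max (1 / v k ^ 2 - 1 / u k ^ 2) 0)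
    (hexc : ∀ u, SeqBox γ u → B u ≤ B' u)
    (hh' : SeqBox γ h') {y : ℝ} (hy : 0 < y) (hyγ : y ≤ γ) (hf' : MemFlow B' y h') (n : ℕ) :
    (B' (fun i => h' (n + 1 + i)) - B (fun i => h' (n + 1 + i))) - (1 / h' (n + 1) ^ 2 - 1 / S (h' n) 1 ^ 2)
      ≤ ∑ k ∈ range K, Λ k * ∑ l ∈ range (k + 1), max (1 / h' (n + l + 1) ^ 2 - 1 / S (h' (n + l)) 1 ^ 2) 0 := by
  have hpn := hh' n
  have hSn := hS (h' n) hpn.1 hpn.2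
  have hu : SeqBox γ (fun i => S (h' n) (1 + i)) := fun i => hSn.1 (1 + i)
  have hv : SeqBox γ (fun i => h' (n + 1 + i)) := fun i => hh' (n + 1 + i)
  have hlo' : ∀ u, SeqBox γ u → b ≤ B' u := fun u hu => (hlo u hu).trans (hexc u hu)
  have hgu : ∀ k : ℕ, 1 / γ ^ 2 + ((k : ℝ) + 1) * b ≤ 1 / (fun i => S (h' n) (1 + i)) k ^ 2 := by
    intro k
    have := tail_graded hb hlo hSn.1 hpn.1 hpn.2 hSn.2 0 k
    simpa only [zero_add] using this
  have hgv : ∀ k : ℕ, 1 / γ ^ 2 + ((k : ℝ) + 1) * b ≤ 1 / (fun i => h' (n + 1 + i)) k ^ 2 := fun k =>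
    tail_graded hb hlo' hh' hy hyγ hf' n k
  have hdrop := hLip _ _ hu hv hgu hgv
  beta_reduce at hdrop
  have heq := dual_step_eq_levels hS hh' hf' n
  have hsum : ∑ k ∈ range K, Λ k * max (1 / h' (n + 1 + k) ^ 2 - 1 / S (h' n) (1 + k) ^ 2) 0
      ≤ ∑ k ∈ range K, Λ k * ∑ l ∈ range (k + 1), max (1 / h' (n + l + 1) ^ 2 - 1 / S (h' (n + l)) 1 ^ 2) 0 :=
    sum_le_sum fun k _ => mul_le_mul_of_nonneg_left
      (max_le (gap_le_sum_parts hb hmono hB hM hlo hS huniq hh' k n).1 (sum_nonneg fun l _ => le_max_right _ _)) (hΛ k)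
  linarith [hdrop, heq, hsum]

/-- **THE UPPER LINK** (an overshoot `X_n > E_n` is paid by the window's negative parts): same data, `X_n − E_n ≤ Σ_k Λ_k Σ_{l≤k} X⁻_{n+l}` — `X_n − E_n` is MINUS the
memory drop, bounded by the profile against the negative window gaps. [folklore] -/
theorem flow_link_upper {Λ : ℕ → ℝ} {K : ℕ} (hb : 0 < b)
    (hmono : ∀ u v : ℕ → ℝ, SeqBox γ u → SeqBox γ v → (∀ i, u i ≤ v i) → B u ≤ B v)
    (hB : ∀ u u' : ℕ → ℝ, SeqBox γ u → SeqBox γ u' → ∀ D : ℝ, (∀ j, |u j - u' j| ≤ D) → |B u - B u'| ≤ M * D) (hM : 0 ≤ M)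
    (hlo : ∀ u, SeqBox γ u → b ≤ B u)
    (hS : ∀ p, 0 < p → p ≤ γ → SeqBox γ (S p) ∧ MemFlow B p (S p))
    (huniq : ∀ p, 0 < p → p ≤ γ → ∀ u u' : ℕ → ℝ, SeqBox γ u → SeqBox γ u' → MemFlow B p u → MemFlow B p u' → u = u')
    (hΛ : ∀ k, 0 ≤ Λ k)
    (hLip : ∀ u v : ℕ → ℝ, SeqBox γ u → SeqBox γ v → (∀ k : ℕ, 1 / γ ^ 2 + ((k : ℝ) + 1) * b ≤ 1 / u k ^ 2) →
      (∀ k : ℕ, 1 / γ ^ 2 + ((k : ℝ) + 1) * b ≤ 1 / v k ^ 2) → B u - B v ≤ ∑ k ∈ range K, Λ k * max (1 / v k ^ 2 - 1 / u k ^ 2) 0)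
    (hexc : ∀ u, SeqBox γ u → B u ≤ B' u)
    (hh' : SeqBox γ h') {y : ℝ} (hy : 0 < y) (hyγ : y ≤ γ) (hf' : MemFlow B' y h') (n : ℕ) :
    (1 / h' (n + 1) ^ 2 - 1 / S (h' n) 1 ^ 2) - (B' (fun i => h' (n + 1 + i)) - B (fun i => h' (n + 1 + i)))
      ≤ ∑ k ∈ range K, Λ k * ∑ l ∈ range (k + 1), max (-(1 / h' (n + l + 1) ^ 2 - 1 / S (h' (n + l)) 1 ^ 2)) 0 := by
  have hpn := hh' n
  have hSn := hS (h' n) hpn.1 hpn.2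
  have hu : SeqBox γ (fun i => S (h' n) (1 + i)) := fun i => hSn.1 (1 + i)
  have hv : SeqBox γ (fun i => h' (n + 1 + i)) := fun i => hh' (n + 1 + i)
  have hlo' : ∀ u, SeqBox γ u → b ≤ B' u := fun u hu => (hlo u hu).trans (hexc u hu)
  have hgu : ∀ k : ℕ, 1 / γ ^ 2 + ((k : ℝ) + 1) * b ≤ 1 / (fun i => S (h' n) (1 + i)) k ^ 2 := by
    intro k
    have := tail_graded hb hlo hSn.1 hpn.1 hpn.2 hSn.2 0 k
    simpa only [zero_add] using this
  have hgv : ∀ k : ℕ, 1 / γ ^ 2 + ((k : ℝ) + 1) * b ≤ 1 / (fun i => h' (n + 1 + i)) k ^ 2 := fun k =>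
    tail_graded hb hlo' hh' hy hyγ hf' n k
  have hrise := hLip _ _ hv hu hgv hgu
  beta_reduce at hrise
  have heq := dual_step_eq_levels hS hh' hf' n
  have hsum : ∑ k ∈ range K, Λ k * max (1 / S (h' n) (1 + k) ^ 2 - 1 / h' (n + 1 + k) ^ 2) 0
      ≤ ∑ k ∈ range K, Λ k * ∑ l ∈ range (k + 1), max (-(1 / h' (n + l + 1) ^ 2 - 1 / S (h' (n + l)) 1 ^ 2)) 0 :=
    sum_le_sum fun k _ => mul_le_mul_of_nonneg_left
      (max_le (by linarith [(gap_le_sum_parts hb hmono hB hM hlo hS huniq hh' k n).2])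
        (sum_nonneg fun l _ => le_max_right _ _)) (hΛ k)
  linarith [hrise, heq, hsum]

/-- THE INITIAL BOUND: with `b ≤ B ≤ B′ ≤ β̄` on the box, both violations `X⁻_m` and `X_m − E_m` are at most `β̄` (`X_m = B′(tail_{m+1}h′) − B(tail_1 S h′_m)`,
`X_m − E_m = B(tail_{m+1}h′) − B(tail_1 S h′_m)`). [folklore] -/
theorem flow_violation_bound {βb : ℝ} (hb : 0 < b) (hlo : ∀ u, SeqBox γ u → b ≤ B u)
    (hS : ∀ p, 0 < p → p ≤ γ → SeqBox γ (S p) ∧ MemFlow B p (S p))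
    (hexc : ∀ u, SeqBox γ u → B u ≤ B' u) (hbdd : ∀ u, SeqBox γ u → B' u ≤ βb)
    (hh' : SeqBox γ h') {y : ℝ} (hf' : MemFlow B' y h') (m : ℕ) :
    max (-(1 / h' (m + 1) ^ 2 - 1 / S (h' m) 1 ^ 2)) 0 ≤ βb
      ∧ (1 / h' (m + 1) ^ 2 - 1 / S (h' m) 1 ^ 2) - (B' (fun i => h' (m + 1 + i)) - B (fun i => h' (m + 1 + i))) ≤ βb := by
  have hu : SeqBox γ (fun i => S (h' m) (1 + i)) := fun i => (hS (h' m) (hh' m).1 (hh' m).2).1 (1 + i)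
  have hv : SeqBox γ (fun i => h' (m + 1 + i)) := fun i => hh' (m + 1 + i)
  have heq := dual_step_eq_levels hS hh' hf' m
  have h1 := hlo _ hu
  have h2 := hexc _ hu
  have h3 := hbdd _ hu
  have h4 := hlo _ hv
  have h5 := hexc _ hv
  have h6 := hbdd _ hv
  refine ⟨max_le (by linarith) (by linarith), by linarith⟩

/-- THE SOURCE ALONG ONE ORBIT IS NON-INCREASING (isotone excess, `h′` strictly decreasing since `B′ ≥ b > 0`): `E_{n+l+1} ≤ E_n`. [folklore] -/
theorem flow_source_le {b' : ℝ} (hb' : 0 < b') (hlo' : ∀ u, SeqBox γ u → b' ≤ B' u)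
    (hDmono : ∀ u v : ℕ → ℝ, SeqBox γ u → SeqBox γ v → (∀ i, u i ≤ v i) → B' u - B u ≤ B' v - B v)
    (hh' : SeqBox γ h') {y : ℝ} (hf' : MemFlow B' y h') (n l : ℕ) :
    B' (fun i => h' (n + (l + 1) + 1 + i)) - B (fun i => h' (n + (l + 1) + 1 + i))
      ≤ B' (fun i => h' (n + 1 + i)) - B (fun i => h' (n + 1 + i)) := by
  have hanti := (strictAnti_of_memFlow hb' hlo' hh' hf').antitone
  exact hDmono _ _ (fun i => hh' _) (fun i => hh' _) fun i => hanti (by omega)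

/-! ## §4 The dual steps are sandwiched, and the comparison theorem -/

/-- **THE DUAL STEPS ARE SANDWICHED: `0 ≤ X_n ≤ E_n` AT EVERY DEPTH.**  Base `B`: isotone, floor `b > 0`, modulus `M`, unique box solutions `S q`, and a LEVEL-LIPSCHITZ
AGE PROFILE `Λ ≥ 0` on the graded box with STRICT AGE MOMENT `Σ_{k<K} k·Λ_k < 1`.  Perturbed `B′`: `B ≤ B′ ≤ β̄` on the box, excess `B′ − B` isotone; `h′` a box solution of
`B′` from a pin in `]0,γ]`.  Then every dual step `X_n = B′(tail_{n+1}h′) − B(tail_1 S h′_n)` satisfies `0 ≤ X_n ≤ (B′−B)(tail_{n+1}h′)` — by the contraction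
`sandwich_of_links` fed with §3.  No modulus, no threshold, no depth induction; the age-`0` weight `Λ_0` is free. [folklore] -/
theorem dual_steps_sandwich {Λ : ℕ → ℝ} {K : ℕ} {βb : ℝ} (hb : 0 < b)
    (hmono : ∀ u v : ℕ → ℝ, SeqBox γ u → SeqBox γ v → (∀ i, u i ≤ v i) → B u ≤ B v)
    (hB : ∀ u u' : ℕ → ℝ, SeqBox γ u → SeqBox γ u' → ∀ D : ℝ, (∀ j, |u j - u' j| ≤ D) → |B u - B u'| ≤ M * D) (hM : 0 ≤ M)
    (hlo : ∀ u, SeqBox γ u → b ≤ B u)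
    (hS : ∀ p, 0 < p → p ≤ γ → SeqBox γ (S p) ∧ MemFlow B p (S p))
    (huniq : ∀ p, 0 < p → p ≤ γ → ∀ u u' : ℕ → ℝ, SeqBox γ u → SeqBox γ u' → MemFlow B p u → MemFlow B p u' → u = u')
    (hΛ : ∀ k, 0 ≤ Λ k) (hθ : ∑ k ∈ range K, (k : ℝ) * Λ k < 1)
    (hLip : ∀ u v : ℕ → ℝ, SeqBox γ u → SeqBox γ v → (∀ k : ℕ, 1 / γ ^ 2 + ((k : ℝ) + 1) * b ≤ 1 / u k ^ 2) →
      (∀ k : ℕ, 1 / γ ^ 2 + ((k : ℝ) + 1) * b ≤ 1 / v k ^ 2) → B u - B v ≤ ∑ k ∈ range K, Λ k * max (1 / v k ^ 2 - 1 / u k ^ 2) 0)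
    (hexc : ∀ u, SeqBox γ u → B u ≤ B' u) (hbdd : ∀ u, SeqBox γ u → B' u ≤ βb)
    (hDmono : ∀ u v : ℕ → ℝ, SeqBox γ u → SeqBox γ v → (∀ i, u i ≤ v i) → B' u - B u ≤ B' v - B v)
    (hh' : SeqBox γ h') {y : ℝ} (hy : 0 < y) (hyγ : y ≤ γ) (hf' : MemFlow B' y h') (n : ℕ) :
    0 ≤ 1 / h' (n + 1) ^ 2 - 1 / S (h' n) 1 ^ 2
      ∧ 1 / h' (n + 1) ^ 2 - 1 / S (h' n) 1 ^ 2 ≤ B' (fun i => h' (n + 1 + i)) - B (fun i => h' (n + 1 + i)) := by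
  have hlo' : ∀ u, SeqBox γ u → b ≤ B' u := fun u hu => (hlo u hu).trans (hexc u hu)
  exact sandwich_of_links (X := fun m => 1 / h' (m + 1) ^ 2 - 1 / S (h' m) 1 ^ 2)
    (E := fun m => B' (fun i => h' (m + 1 + i)) - B (fun i => h' (m + 1 + i))) hΛ hθ
    (fun m => sub_nonneg.mpr (hexc _ fun i => hh' (m + 1 + i)))
    (fun m l => flow_source_le hb hlo' hDmono hh' hf' m l)
    (fun m => flow_link_lower hb hmono hB hM hlo hS huniq hΛ hLip hexc hh' hy hyγ hf' m)
    (fun m => flow_link_upper hb hmono hB hM hlo hS huniq hΛ hLip hexc hh' hy hyγ hf' m)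
    (fun m => flow_violation_bound hb hlo hS hexc hbdd hh' hf' m) n

/-- **COMPARISON FOR EVERY ISOTONE EXCESS OVER EVERY MEMORY WITH AGE MOMENT `Σ_k k·Λ_k < 1` — THE CONTRACTION CLASS.**  `B`: isotone on the box `]0,γ]^ℕ` with a
zeroth moment `M` and floor `b > 0`, and LEVEL-LIPSCHITZ IN ITS HISTORY with age profile `Λ ≥ 0`: `B u − B v ≤ Σ_{k<K} Λ_k·(1∕v_k² − 1∕u_k²)⁺` for box configurations
whose age-`k` levels are `≥ 1∕γ² + (k+1)·b` (all that any orbit tail visits), with `Σ_{k<K} k·Λ_k < 1`.  `B′`: ANY functional with `B ≤ B′ ≤ β̄` on the box and ISOTONE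
excess `B′ − B` (no modulus, no steepness, no size).  `h`, `h′`: ANY box solutions of `B`, `B′` from one pin `p`.  Then **`h′ ≤ h` at every scale.**  SHARP: (E56a)'s hinge
memory `b + M̃·max(1 − 1∕u_L², 0)` has the one-age profile `Λ_L = M̃`, and comparison FAILS there as soon as `L·M̃ > 1` (`…ComparisonIsotoneExcessSharp.h_one_lt_h'_one`).
Proof: existence (E39) and uniqueness (E43b) of the base family, `dual_steps_sandwich`, (E132) `cmp_of_dual_steps_nonneg`. [folklore] -/
theorem le_of_isotone_excess_moment {Λ : ℕ → ℝ} {K : ℕ} {βb p : ℝ}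
    (hmono : ∀ u v : ℕ → ℝ, SeqBox γ u → SeqBox γ v → (∀ i, u i ≤ v i) → B u ≤ B v)
    (hB : ∀ u u' : ℕ → ℝ, SeqBox γ u → SeqBox γ u' → ∀ D : ℝ, (∀ j, |u j - u' j| ≤ D) → |B u - B u'| ≤ M * D) (hM : 0 ≤ M)
    (hb : 0 < b) (hlo : ∀ u, SeqBox γ u → b ≤ B u)
    (hΛ : ∀ k, 0 ≤ Λ k) (hθ : ∑ k ∈ range K, (k : ℝ) * Λ k < 1)
    (hLip : ∀ u v : ℕ → ℝ, SeqBox γ u → SeqBox γ v → (∀ k : ℕ, 1 / γ ^ 2 + ((k : ℝ) + 1) * b ≤ 1 / u k ^ 2) →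
      (∀ k : ℕ, 1 / γ ^ 2 + ((k : ℝ) + 1) * b ≤ 1 / v k ^ 2) → B u - B v ≤ ∑ k ∈ range K, Λ k * max (1 / v k ^ 2 - 1 / u k ^ 2) 0)
    (hexc : ∀ u, SeqBox γ u → B u ≤ B' u) (hbdd : ∀ u, SeqBox γ u → B' u ≤ βb)
    (hDmono : ∀ u v : ℕ → ℝ, SeqBox γ u → SeqBox γ v → (∀ i, u i ≤ v i) → B' u - B u ≤ B' v - B v)
    (hp : 0 < p) (hpγ : p ≤ γ) (hh : SeqBox γ h) (hf : MemFlow B p h) (hh' : SeqBox γ h') (hf' : MemFlow B' p h') (j : ℕ) :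
    h' j ≤ h j := by
  -- the unique base family
  have hex : ∀ q : ℝ, 0 < q → q ≤ γ → ∃ k : ℕ → ℝ, SeqBox γ k ∧ MemFlow B q k :=
    fun q hq hqγ => Summit.QuantumFields.BalabanUV.Beta.EriceRemainderEnclosureHistoryAutonomyExistence.exists_memFlow_zm hB hM hq hqγ hb hlo
  choose! S hSb hSf using hex
  have hS : ∀ q, 0 < q → q ≤ γ → SeqBox γ (S q) ∧ MemFlow B q (S q) := fun q hq hqγ => ⟨hSb q hq hqγ, hSf q hq hqγ⟩
  have huniq : ∀ q, 0 < q → q ≤ γ → ∀ u u' : ℕ → ℝ, SeqBox γ u → SeqBox γ u' → MemFlow B q u → MemFlow B q u' → u = u' :=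
    fun q hq _ u u' hu hu' hfu hfu' =>
      Summit.QuantumFields.BalabanUV.Beta.EriceRemainderEnclosureHistoryAutonomyMonotoneGeneral.memFlow_unique_of_monotone_zm hmono hB hM hq hb hlo hu hu' hfu hfu'
  have e : h = S p := huniq p hp hpγ _ _ hh (hS p hp hpγ).1 hf (hS p hp hpγ).2
  rw [e]
  refine cmp_of_dual_steps_nonneg (B' := B') hb hB hM hlo hS huniq hp hpγ hh' hf' j (fun i _ => ?_) j le_rfl
  have h0 := (dual_steps_sandwich hb hmono hB hM hlo hS huniq hΛ hθ hLip hexc hbdd hDmono hh' hp hpγ hf' i).1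
  have heq := dual_step_eq_levels hS hh' hf' i
  linarith

end Summit.QuantumFields.BalabanUV.Beta.EriceRemainderEnclosureHistoryAutonomyComparisonDualContraction

end
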